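import Literature.ModelTheory.ExponentialFields.SemialgebraicDimension
import Literature.ModelTheory.ExponentialFields.SemialgebraicC1TriangulationLifting
import HarnessLib

/-!
# Cluster sets of semialgebraic functions at boundary points

Topic `Literature/ModelTheory/ExponentialFields` — block B4₀ of the proof of the
`C¹`-triangulation theorem for compact semialgebraic sets
(`Literature.ModelTheory.ExponentialFields.OhmotoShiota2017_c1Triangulation`, statement of
[OhmotoShiota2017, Thm. 1.1]) along the proof of [Pawlucki2024], specialized to `p = 1`.

The tool behind [Pawlucki2024, Thm. 5.3] (the `C¹`-extension theorem, [Pawlucki1985, Prop. 2]):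
the set `Lim_{z → p} h(z)` of finite limit values (cluster set) of a function `h` continuous on a
set `S` at a point `p ∈ cl S`:

* it is closed, and an interval as soon as `S` is convex near `p` (intermediate values along
  segments; this is the Łojasiewicz `(s)`-condition in its simplest instance);
* if it is contained in `{v₀}` and contains `v₀` then `h → v₀` at `p` within `S`;
* for semialgebraic `h` on `S = G × (0, η)` the cluster sets at the boundary points `(a, 0)` are
  the fibres of `cl Γ_h ∩ {t = 0}`, a semialgebraic set of dimension `< dim Γ_h ≤ m + 1`
  [Dries1998, Ch. 4 (1.8)]; by the fibre-dimension formula [Dries1998, Ch. 4 (1.5)] the set of `a`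
  with a nondegenerate cluster interval has dimension `< m`, i.e. is nowhere dense: off it, bounded
  `h` has a limit at `(a, 0⁺)`, depending continuously on `a`.

No named facts are introduced (D-0026).

## References

* [Pawlucki2024] W. Pawłucki, *Strict `C^p`-triangulations — a new approach to
  desingularization*, J. Eur. Math. Soc. 26 (2024), 3863–3909, Thm. 5.3 and its proof.
* [Dries1998] L. van den Dries, *Tame topology and o-minimal structures*, Ch. 4 (1.5), (1.8).
* [OhmotoShiota2017] T. Ohmoto, M. Shiota, *`C¹`-triangulations of semialgebraic sets*,
  J. Topology 10 (2017), Thm. 1.1 (statement only).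
-/

noncomputable section

open Set Filter Metric
open _root_.Topology

namespace Literature.ModelTheory.ExponentialFields

open Literature.NumberTheory.Transcendental (IsSemialgebraicFunOn IsSemialgebraicMapOn
  isSemialgebraicFunOn_iff isSemialgebraicMapOn_iff_forall_holds)

section Cluster

variable {n : ℕ}

/-! ### Cluster sets -/

/-- The **cluster set** (set of finite limit values) of `h` at `p` along `S`.
[cite: Pawlucki2024, Thm. 5.3 (proof), footnote 2] -/
def clusterSet (h : (Fin n → ℝ) → ℝ) (S : Set (Fin n → ℝ)) (p : Fin n → ℝ) : Set ℝ :=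
  {v | ∀ ε > 0, ∀ δ > 0, ∃ z ∈ S, dist z p < δ ∧ dist (h z) v < ε}

variable {h : (Fin n → ℝ) → ℝ} {S : Set (Fin n → ℝ)} {p : Fin n → ℝ}

/-- The cluster set is closed. [cite: Pawlucki2024, Thm. 5.3 (proof)] -/
theorem isClosed_clusterSet : IsClosed (clusterSet h S p) := by
  refine isClosed_of_closure_subset fun v hv ε hε δ hδ => ?_
  obtain ⟨v', hv', hvv'⟩ := Metric.mem_closure_iff.1 hv (ε / 2) (half_pos hε)
  obtain ⟨z, hzS, hzp, hzv⟩ := hv' (ε / 2) (half_pos hε) δ hδ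
  refine ⟨z, hzS, hzp, ?_⟩
  calc dist (h z) v ≤ dist (h z) v' + dist v' v := dist_triangle _ _ _
    _ < ε / 2 + ε / 2 := add_lt_add hzv (by rw [dist_comm]; exact hvv')
    _ = ε := by ring

/-- A value attained on `S` arbitrarily close to `p` is a cluster value. [cite: Pawlucki2024, Thm. 5.3] -/
theorem mem_clusterSet_of_forall_exists {v : ℝ} (hv : ∀ δ > 0, ∃ z ∈ S, dist z p < δ ∧ h z = v) :
    v ∈ clusterSet h S p := fun ε hε δ hδ => by
  obtain ⟨z, hzS, hzp, hzv⟩ := hv δ hδ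
  exact ⟨z, hzS, hzp, by rw [hzv, dist_self]; exact hε⟩

/-- The limit is a cluster value (when `S` accumulates at `p`). [cite: Pawlucki2024, Thm. 5.3] -/
theorem mem_clusterSet_of_tendsto {v : ℝ} [NeBot (𝓝[S] p)] (hv : Tendsto h (𝓝[S] p) (𝓝 v)) :
    v ∈ clusterSet h S p := fun ε hε δ hδ => by
  have h1 : ∀ᶠ z in 𝓝[S] p, dist (h z) v < ε := hv (ball_mem_nhds v hε)
  have h2 : ∀ᶠ z in 𝓝[S] p, dist z p < δ := mem_nhdsWithin_of_mem_nhds (ball_mem_nhds p hδ)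
  have h3 : ∀ᶠ z in 𝓝[S] p, z ∈ S := self_mem_nhdsWithin
  obtain ⟨z, hz1, hz2, hz3⟩ := (h1.and (h2.and h3)).exists
  exact ⟨z, hz3, hz2, hz1⟩

/-- **Intermediate values**: if `S ∩ ball p δ` is convex for small `δ` and `h` is continuous on `S`
then the cluster set is order-connected (an interval).
[cite: Pawlucki2024, Thm. 5.3 (proof): "a closed nonempty interval, because `S` satisfies the
Łojasiewicz `(s)`-condition"] -/
theorem ordConnected_clusterSet (hc : ContinuousOn h S) {δ₀ : ℝ} (hδ₀ : 0 < δ₀)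
    (hconv : ∀ δ, 0 < δ → δ ≤ δ₀ → Convex ℝ (S ∩ ball p δ)) : OrdConnected (clusterSet h S p) := by
  refine ⟨fun v₁ hv₁ v₂ hv₂ v hv => ?_⟩
  rcases eq_or_lt_of_le hv.1 with rfl | hlt₁
  · exact hv₁
  rcases eq_or_lt_of_le hv.2 with rfl | hlt₂
  · exact hv₂
  intro ε hε δ hδ
  -- work in the convex piece `S ∩ ball p δ'`, `δ' = min δ δ₀`
  set δ' := min δ δ₀ with hδ'
  have hδ'pos : 0 < δ' := lt_min hδ hδ₀
  obtain ⟨z₁, hz₁S, hz₁p, hz₁v⟩ := hv₁ (v - v₁) (sub_pos.2 hlt₁) δ' hδ'pos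
  obtain ⟨z₂, hz₂S, hz₂p, hz₂v⟩ := hv₂ (v₂ - v) (sub_pos.2 hlt₂) δ' hδ'pos
  have h1 : h z₁ < v := by
    have := (abs_sub_lt_iff.1 (Real.dist_eq (h z₁) v₁ ▸ hz₁v)).1; linarith
  have h2 : v < h z₂ := by
    have := (abs_sub_lt_iff.1 (Real.dist_eq (h z₂) v₂ ▸ hz₂v)).2; linarith
  have hK := hconv δ' hδ'pos (min_le_right _ _)
  have hpre : IsPreconnected (S ∩ ball p δ') := hK.isPreconnected
  obtain ⟨z, ⟨hzS, hzp⟩, hzv⟩ := hpre.intermediate_value ⟨hz₁S, hz₁p⟩ ⟨hz₂S, hz₂p⟩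
    (hc.mono inter_subset_left) ⟨h1.le, h2.le⟩
  exact ⟨z, hzS, (mem_ball.1 hzp).trans_le (min_le_left _ _), by rw [hzv, dist_self]; exact hε⟩

/-- **Non-convergence produces a second cluster value**: if `v₀` is a cluster value but `h` does
not tend to `v₀`, then (with convex pieces) some `v ≠ v₀` is a cluster value.
[cite: Pawlucki2024, Thm. 5.3 (proof)] -/
theorem exists_mem_clusterSet_ne (hc : ContinuousOn h S) {δ₀ : ℝ} (hδ₀ : 0 < δ₀)
    (hconv : ∀ δ, 0 < δ → δ ≤ δ₀ → Convex ℝ (S ∩ ball p δ)) {v₀ : ℝ} (hv₀ : v₀ ∈ clusterSet h S p)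
    (hnt : ¬ Tendsto h (𝓝[S] p) (𝓝 v₀)) : ∃ v ∈ clusterSet h S p, v ≠ v₀ := by
  -- extract `ε₀ > 0` and bad points arbitrarily close to `p`
  have hbad : ∃ ε₀ > 0, ∀ δ > 0, ∃ z ∈ S, dist z p < δ ∧ ε₀ ≤ dist (h z) v₀ := by
    by_contra hall
    push Not at hall
    apply hnt
    rw [Metric.tendsto_nhds]
    intro ε hε
    obtain ⟨δ, hδ, hgood⟩ := hall ε hε
    have h1 : ∀ᶠ z in 𝓝[S] p, dist z p < δ := mem_nhdsWithin_of_mem_nhds (ball_mem_nhds p hδ)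
    filter_upwards [h1, self_mem_nhdsWithin] with z hz hzS using hgood z hzS hz
  obtain ⟨ε₀, hε₀, hbad⟩ := hbad
  -- for each `δ`, the value `v₀ + ε₀/2` or `v₀ - ε₀/2` is attained in `S ∩ ball p δ`
  have hattain : ∀ δ > 0, ∃ z ∈ S, dist z p < δ ∧ (h z = v₀ + ε₀ / 2 ∨ h z = v₀ - ε₀ / 2) := by
    intro δ hδ
    set δ' := min δ δ₀ with hδ'
    have hδ'pos : 0 < δ' := lt_min hδ hδ₀
    obtain ⟨z, hzS, hzp, hzbad⟩ := hbad δ' hδ'pos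
    obtain ⟨w, hwS, hwp, hwgood⟩ := hv₀ (ε₀ / 2) (half_pos hε₀) δ' hδ'pos
    have hK := hconv δ' hδ'pos (min_le_right _ _)
    have hpre : IsPreconnected (S ∩ ball p δ') := hK.isPreconnected
    rw [Real.dist_eq] at hzbad hwgood
    rcases le_abs.1 hzbad with hge | hge
    · -- `h z ≥ v₀ + ε₀ > v₀ + ε₀/2 > h w`
      have hw' : h w ≤ v₀ + ε₀ / 2 := by have := (abs_lt.1 hwgood).2; linarith
      obtain ⟨y, ⟨hyS, hyp⟩, hyv⟩ := hpre.intermediate_value ⟨hwS, hwp⟩ ⟨hzS, hzp⟩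
        (hc.mono inter_subset_left) ⟨hw', by linarith⟩
      exact ⟨y, hyS, (mem_ball.1 hyp).trans_le (min_le_left _ _), Or.inl hyv⟩
    · have hw' : v₀ - ε₀ / 2 ≤ h w := by have := (abs_lt.1 hwgood).1; linarith
      obtain ⟨y, ⟨hyS, hyp⟩, hyv⟩ := hpre.intermediate_value ⟨hzS, hzp⟩ ⟨hwS, hwp⟩
        (hc.mono inter_subset_left) ⟨by linarith, hw'⟩
      exact ⟨y, hyS, (mem_ball.1 hyp).trans_le (min_le_left _ _), Or.inr hyv⟩
  -- one of the two values is attained for arbitrarily small `δ`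
  by_cases hplus : ∀ δ > 0, ∃ z ∈ S, dist z p < δ ∧ h z = v₀ + ε₀ / 2
  · exact ⟨v₀ + ε₀ / 2, mem_clusterSet_of_forall_exists hplus, by linarith⟩
  · push Not at hplus
    obtain ⟨δ₁, hδ₁, hno⟩ := hplus
    refine ⟨v₀ - ε₀ / 2, mem_clusterSet_of_forall_exists fun δ hδ => ?_, by linarith⟩
    obtain ⟨z, hzS, hzp, hz⟩ := hattain (min δ δ₁) (lt_min hδ hδ₁)
    rcases hz with hz | hz
    · exact absurd hz (hno z hzS (hzp.trans_le (min_le_right _ _)))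
    · exact ⟨z, hzS, hzp.trans_le (min_le_left _ _), hz⟩

/-- **Convergence from a singleton cluster set.** [cite: Pawlucki2024, Thm. 5.3 (proof)] -/
theorem tendsto_of_clusterSet_subset (hc : ContinuousOn h S) {δ₀ : ℝ} (hδ₀ : 0 < δ₀)
    (hconv : ∀ δ, 0 < δ → δ ≤ δ₀ → Convex ℝ (S ∩ ball p δ)) {v₀ : ℝ} (hv₀ : v₀ ∈ clusterSet h S p)
    (hsub : clusterSet h S p ⊆ {v₀}) : Tendsto h (𝓝[S] p) (𝓝 v₀) := by
  by_contra hnt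
  obtain ⟨v, hv, hne⟩ := exists_mem_clusterSet_ne hc hδ₀ hconv hv₀ hnt
  exact hne (hsub hv)

/-- Bounded functions have cluster values (when `S` accumulates at `p`). [cite: Pawlucki2024, Thm. 5.3] -/
theorem clusterSet_nonempty_of_bounded {M : ℝ} (hM : ∀ z ∈ S, |h z| ≤ M) (hp : p ∈ closure S) :
    (clusterSet h S p).Nonempty := by
  -- a sequence in `S` tending to `p`; a convergent subsequence of its values
  obtain ⟨u, huS, hup⟩ := mem_closure_iff_seq_limit.1 hp
  have hbdd : ∀ k, h (u k) ∈ Icc (-M) M := fun k => abs_le.1 (hM _ (huS k))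
  obtain ⟨v, -, φ, hφ, hv⟩ := (isCompact_Icc : IsCompact (Icc (-M) M)).tendsto_subseq hbdd
  refine ⟨v, fun ε hε δ hδ => ?_⟩
  have h1 : ∀ᶠ k in atTop, dist (h (u (φ k))) v < ε := hv (ball_mem_nhds v hε)
  have h2 : ∀ᶠ k in atTop, dist (u (φ k)) p < δ :=
    (hup.comp hφ.tendsto_atTop) (ball_mem_nhds p hδ)
  obtain ⟨k, hk1, hk2⟩ := (h1.and h2).exists
  exact ⟨u (φ k), huS _, hk2, hk1⟩

/-- **Continuity of the limit function**: if `h → λ a` at `q a` within `S` for all `a` in a set `U`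
on which `q` is continuous and `S` accumulates at `q a`, then `λ` is continuous on `U`.
[cite: Pawlucki2024, Thm. 5.3 (proof, "g is of class C¹ on G ∖ Z" — continuity part)] -/
theorem continuousOn_of_tendsto {m : ℕ} {U : Set (Fin m → ℝ)} {q : (Fin m → ℝ) → (Fin n → ℝ)} (hq : ContinuousOn q U)
    {lam : (Fin m → ℝ) → ℝ} (hacc : ∀ a ∈ U, NeBot (𝓝[S] (q a)))
    (hlim : ∀ a ∈ U, Tendsto h (𝓝[S] (q a)) (𝓝 (lam a))) : ContinuousOn lam U := by
  intro a ha
  rw [ContinuousWithinAt, Metric.tendsto_nhds]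
  intro ε hε
  -- `h` is `ε/2`-close to `lam a` on `S ∩ ball (q a) δ`
  obtain ⟨δ, hδ, hball⟩ : ∃ δ > 0, ∀ z ∈ S, dist z (q a) < δ → dist (h z) (lam a) < ε / 2 := by
    have h1 := Metric.tendsto_nhds.1 (hlim a ha) (ε / 2) (half_pos hε)
    obtain ⟨U', hU', hsub⟩ := eventually_iff_exists_mem.1 h1
    obtain ⟨O, hO, hOS⟩ := mem_nhdsWithin_iff_exists_mem_nhds_inter.1 hU'
    obtain ⟨δ, hδ, hballO⟩ := Metric.mem_nhds_iff.1 hO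
    exact ⟨δ, hδ, fun z hzS hz => hsub z (hOS ⟨hballO hz, hzS⟩)⟩
  -- for `a'` near `a`, `q a'` is within `δ/2` of `q a`
  have hq' : ∀ᶠ a' in 𝓝[U] a, dist (q a') (q a) < δ / 2 := Metric.tendsto_nhds.1 (hq a ha) (δ / 2) (half_pos hδ)
  filter_upwards [hq', self_mem_nhdsWithin] with a' ha' ha'U
  -- `lam a'` is a limit of values `ε/2`-close to `lam a`
  haveI := hacc a' ha'U
  have hev : ∀ᶠ z in 𝓝[S] (q a'), dist (h z) (lam a) < ε / 2 := by
    have h2 : ∀ᶠ z in 𝓝[S] (q a'), dist z (q a') < δ / 2 := mem_nhdsWithin_of_mem_nhds (ball_mem_nhds _ (half_pos hδ))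
    filter_upwards [h2, self_mem_nhdsWithin] with z hz hzS
    refine hball z hzS ?_
    calc dist z (q a) ≤ dist z (q a') + dist (q a') (q a) := dist_triangle _ _ _
      _ < δ / 2 + δ / 2 := add_lt_add hz ha'
      _ = δ := by ring
  have hle : dist (lam a') (lam a) ≤ ε / 2 := by
    have ht : Tendsto (fun z => dist (h z) (lam a)) (𝓝[S] (q a')) (𝓝 (dist (lam a') (lam a))) :=
      (hlim a' ha'U).dist tendsto_const_nhds
    exact le_of_tendsto ht (hev.mono fun z hz => hz.le)
  linarith

end Cluster

/-! ### Cluster sets at the bottom of a half-box: semialgebraicity and the dimension count -/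

section HalfBox

variable {m : ℕ}

open Literature.NumberTheory.Transcendental.SemialgebraicMonotonicity (sa_exists sa_eq sa_lt sa_const_lt sa_lt_const sa_and)

/-- The half-box `G × (0, η)` in `snoc` coordinates. [cite: Pawlucki2024, Thm. 5.3] -/
def halfBox (G : Set (Fin m → ℝ)) (η : ℝ) : Set (Fin (m + 1) → ℝ) :=
  {z | Fin.init z ∈ G ∧ 0 < z (Fin.last m) ∧ z (Fin.last m) < η}

/-- `snoc x t ∈ halfBox G η ↔ x ∈ G ∧ 0 < t < η`. [cite: Pawlucki2024, Thm. 5.3] -/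
@[simp] theorem snoc_mem_halfBox {G : Set (Fin m → ℝ)} {η : ℝ} {x : Fin m → ℝ} {t : ℝ} :
    (Fin.snoc x t : Fin (m + 1) → ℝ) ∈ halfBox G η ↔ x ∈ G ∧ 0 < t ∧ t < η := by simp [halfBox]

/-- The half-box is semialgebraic. [cite: Pawlucki2024, Thm. 5.3] -/
theorem isSemialgebraic_halfBox {G : Set (Fin m → ℝ)} (hG : IsSemialgebraic ℝ G) (η : ℝ) :
    IsSemialgebraic ℝ (halfBox G η) :=
  hG.setOf_init_mem.inter ((sa_const_lt _ _).inter (sa_lt_const _ _))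

/-- Distance between `snoc`s (sup metric). [folklore] -/
theorem dist_snoc_snoc_max {n : ℕ} (y x : Fin n → ℝ) (s t : ℝ) :
    dist (Fin.snoc y s : Fin (n + 1) → ℝ) (Fin.snoc x t) = max (dist y x) (dist s t) := by
  apply le_antisymm
  · refine (dist_pi_le_iff (le_max_of_le_left dist_nonneg)).2 fun i => ?_
    refine Fin.lastCases ?_ (fun j => ?_) i
    · simp only [Fin.snoc_last]; exact le_max_right _ _
    · simp only [Fin.snoc_castSucc]; exact (dist_le_pi_dist y x j).trans (le_max_left _ _)
  · refine max_le ?_ ?_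
    · refine (dist_pi_le_iff dist_nonneg).2 fun j => ?_
      have h := dist_le_pi_dist (Fin.snoc y s : Fin (n + 1) → ℝ) (Fin.snoc x t) (Fin.castSucc j)
      simpa only [Fin.snoc_castSucc] using h
    · have h := dist_le_pi_dist (Fin.snoc y s : Fin (n + 1) → ℝ) (Fin.snoc x t) (Fin.last n)
      simpa only [Fin.snoc_last] using h

/-- `Fin.snoc` is jointly continuous. [folklore] -/
theorem continuous_snoc_pair {n : ℕ} : Continuous fun p : (Fin n → ℝ) × ℝ => (Fin.snoc p.1 p.2 : Fin (n + 1) → ℝ) := by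
  refine continuous_pi fun i => ?_
  refine Fin.lastCases ?_ (fun j => ?_) i
  · simp only [Fin.snoc_last]; exact continuous_snd
  · simp only [Fin.snoc_castSucc]; exact (continuous_apply j).comp continuous_fst

/-- Every vector is a `snoc`. [folklore] -/
theorem snoc_init_self {n : ℕ} (z : Fin (n + 1) → ℝ) : Fin.snoc (Fin.init z) (z (Fin.last n)) = z := Fin.snoc_init_self z

variable {n : ℕ} {h : (Fin n → ℝ) → ℝ} {S : Set (Fin n → ℝ)} {p : Fin n → ℝ}

/-- **The cluster set as a fibre of the closure of the graph.** [cite: Pawlucki2024, Thm. 5.3 (proof)] -/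
theorem mem_clusterSet_iff_snoc_mem_closure {v : ℝ} :
    v ∈ clusterSet h S p ↔ (Fin.snoc p v : Fin (n + 1) → ℝ) ∈ closure (graphOver S h) := by
  rw [Metric.mem_closure_iff]
  constructor
  · intro hv ε hε
    obtain ⟨z, hzS, hzp, hzv⟩ := hv ε hε ε hε
    refine ⟨Fin.snoc z (h z), ⟨by simp [hzS], by simp⟩, ?_⟩
    rw [dist_comm, dist_snoc_snoc_max]; exact max_lt hzp hzv
  · intro hv ε hε δ hδ
    obtain ⟨w, ⟨hwS, hwh⟩, hw⟩ := hv (min ε δ) (lt_min hε hδ)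
    rw [← snoc_init_self w, hwh, dist_comm, dist_snoc_snoc_max] at hw
    exact ⟨Fin.init w, hwS, (le_max_left _ _).trans_lt (hw.trans_le (min_le_right _ _)),
      (le_max_right _ _).trans_lt (hw.trans_le (min_le_left _ _))⟩

variable {G : Set (Fin m → ℝ)} {η : ℝ} {f : (Fin (m + 1) → ℝ) → ℝ}

/-- Small balls around bottom points meet the half-box in convex sets. [cite: Pawlucki2024, Thm. 5.3] -/
theorem convex_halfBox_inter_ball {a : Fin m → ℝ} {δ₀ : ℝ} (hδ₀ : ball a δ₀ ⊆ G)
    {δ : ℝ} (hδle : δ ≤ δ₀) :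
    Convex ℝ (halfBox G η ∩ ball (Fin.snoc a 0 : Fin (m + 1) → ℝ) δ) := by
  -- the linear maps `init` and `last`
  set initL : (Fin (m + 1) → ℝ) →ₗ[ℝ] (Fin m → ℝ) :=
    { toFun := fun z => Fin.init z, map_add' := fun _ _ => rfl, map_smul' := fun _ _ => rfl } with hinitL
  have hlast : IsLinearMap ℝ fun z : Fin (m + 1) → ℝ => z (Fin.last m) := ⟨fun _ _ => rfl, fun _ _ => rfl⟩
  -- the intersection is `{z | dist (init z) a < δ ∧ 0 < z last < min η δ}`
  have h : halfBox G η ∩ ball (Fin.snoc a 0 : Fin (m + 1) → ℝ) δ =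
      initL ⁻¹' ball a δ ∩ ({z | 0 < z (Fin.last m)} ∩ ({z | z (Fin.last m) < η} ∩ {z | z (Fin.last m) < δ})) := by
    ext z
    rw [← snoc_init_self z]
    simp only [mem_inter_iff, snoc_mem_halfBox, mem_ball, dist_snoc_snoc_max, max_lt_iff, mem_setOf_eq,
      Fin.snoc_last, mem_preimage, hinitL, LinearMap.coe_mk, AddHom.coe_mk, Fin.init_snoc]
    constructor
    · rintro ⟨⟨-, h0, hη'⟩, hd, habs⟩
      refine ⟨hd, h0, hη', ?_⟩
      rw [Real.dist_eq, sub_zero] at habs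
      exact (le_abs_self _).trans_lt habs
    · rintro ⟨hd, h0, hη', hδ'⟩
      refine ⟨⟨hδ₀ (mem_ball.2 (hd.trans_le hδle)), h0, hη'⟩, hd, ?_⟩
      rw [Real.dist_eq, sub_zero, abs_of_pos h0]; exact hδ'
  rw [h]
  exact ((convex_ball a δ).linear_preimage initL).inter ((convex_halfSpace_gt hlast 0).inter
    ((convex_halfSpace_lt hlast η).inter (convex_halfSpace_lt hlast δ)))

/-- Bottom points are in the closure of the half-box; indeed the half-box accumulates there.
[cite: Pawlucki2024, Thm. 5.3] -/
theorem neBot_nhdsWithin_halfBox (hη : 0 < η) {a : Fin m → ℝ} (ha : a ∈ G) :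
    NeBot (𝓝[halfBox G η] (Fin.snoc a 0 : Fin (m + 1) → ℝ)) := by
  refine mem_closure_iff_nhdsWithin_neBot.1 (Metric.mem_closure_iff.2 fun ε hε => ?_)
  refine ⟨Fin.snoc a (min (ε / 2) (η / 2)), snoc_mem_halfBox.2 ⟨ha, lt_min (half_pos hε) (half_pos hη),
    (min_le_right _ _).trans_lt (half_lt_self hη)⟩, ?_⟩
  rw [dist_comm, dist_snoc_snoc_max, dist_self, max_eq_right dist_nonneg, Real.dist_eq, sub_zero,
    abs_of_pos (lt_min (half_pos hε) (half_pos hη))]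
  exact (min_le_left _ _).trans_lt (half_lt_self hε)

/-- The cluster sets at bottom points are intervals. [cite: Pawlucki2024, Thm. 5.3 (proof)] -/
theorem ordConnected_clusterSet_halfBox (hG : IsOpen G) (hc : ContinuousOn f (halfBox G η))
    {a : Fin m → ℝ} (ha : a ∈ G) : OrdConnected (clusterSet f (halfBox G η) (Fin.snoc a 0)) := by
  obtain ⟨δ₀, hδ₀, hball⟩ := Metric.isOpen_iff.1 hG a ha
  exact ordConnected_clusterSet hc hδ₀ fun δ _ hδle => convex_halfBox_inter_ball hball hδle

/-! #### The dimension count -/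

/-- `Fin.append x y = Fin.snoc x (y 0)` for `y ∈ ℝ¹`. [folklore] -/
theorem append_one_eq_snoc' {k : ℕ} (x : Fin k → ℝ) (y : Fin 1 → ℝ) : Fin.append x y = Fin.snoc x (y 0) := by
  funext i
  refine Fin.lastCases ?_ (fun j => ?_) i
  · have hh : Fin.last k = Fin.natAdd k (0 : Fin 1) := by ext; simp
    rw [Fin.snoc_last, hh, Fin.append_right]
  · have hh : Fin.castSucc j = Fin.castAdd 1 j := rfl
    rw [Fin.snoc_castSucc, hh, Fin.append_left]

/-- **Generic uniqueness of limit values** [Pawlucki2024, Thm. 5.3, proof: "Since `⋃ {a} × Lim`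
… is of dimension `n - 1`, there exists a closed nowhere dense `E` such that a finite limit
exists for each `a ∈ G ∖ E`"]: the set of bottom points with two distinct cluster values of a
continuous semialgebraic function on the half-box is contained in a semialgebraic set of
dimension `< m`. [cite: Pawlucki2024, Thm. 5.3 (proof); Dries1998, Ch. 4 (1.5), (1.8)] -/
theorem exists_small_of_two_clusterValues (hG : IsOpen G) (hGs : IsSemialgebraic ℝ G)
    (hc : ContinuousOn f (halfBox G η)) (hs : IsSemialgebraicFunOn ℝ (halfBox G η) f) :
    ∃ Z : Set (Fin m → ℝ), IsSemialgebraic ℝ Z ∧ (Z = ∅ ∨ sdim Z < m) ∧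
      {a | a ∈ G ∧ ∃ v₁ ∈ clusterSet f (halfBox G η) (Fin.snoc a 0),
        ∃ v₂ ∈ clusterSet f (halfBox G η) (Fin.snoc a 0), v₁ ≠ v₂} ⊆ Z := by
  classical
  set S := halfBox G η with hS
  have hSsa : IsSemialgebraic ℝ S := isSemialgebraic_halfBox hGs η
  set Γ : Set (Fin (m + 1 + 1) → ℝ) := graphOver S f with hΓ
  have hΓsa : IsSemialgebraic ℝ Γ := isSemialgebraicFunOn_iff.mp hs
  -- `dim Γ ≤ m + 1`
  have hΓdim : sdim Γ ≤ m + 1 := by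
    have himg : (fun z : Fin (m + 1) → ℝ => (Fin.snoc z (f z) : Fin (m + 1 + 1) → ℝ)) '' S = Γ := by
      ext w; constructor
      · rintro ⟨z, hz, rfl⟩; exact ⟨by simp [hz], by simp⟩
      · rintro ⟨hw, hwh⟩
        refine ⟨Fin.init w, hw, ?_⟩
        show Fin.snoc (Fin.init w) (f (Fin.init w)) = w
        rw [← hwh, snoc_init_self]
    rw [← himg]
    exact (sdim_image_le hSsa (continuous_snoc_pair.comp_continuousOn (continuousOn_id.prodMk hc))
      (isSemialgebraicMapOn_snoc hSsa hs)).trans (sdim_le _)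
  -- the bottom slice `L` of `cl Γ`
  set L : Set (Fin (m + 1 + 1) → ℝ) := closure Γ ∩ {w | w (Fin.castSucc (Fin.last m)) = 0} with hL
  have hLsa : IsSemialgebraic ℝ L := (isSemialgebraic_closure hΓsa).inter (by
    simpa using isSemialgebraic_setOf_eval_eq_zero (k := ℝ) (R := ℝ)
      (MvPolynomial.X (Fin.castSucc (Fin.last m)) : MvPolynomial (Fin (m + 1 + 1)) ℝ))
  have hLsub : L ⊆ closure Γ \ Γ := by
    rintro w ⟨hw, hw0⟩
    refine ⟨hw, fun hwΓ => ?_⟩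
    have h := hwΓ.1.2.1
    simp only [Fin.init] at h
    rw [show w (Fin.castSucc (Fin.last m)) = 0 from hw0] at h
    exact lt_irrefl _ h
  have hLdim : L = ∅ ∨ sdim L ≤ m := by
    rcases sdim_closure_diff_lt (m + 1 + 1) hΓsa with h | h
    · left; exact subset_eq_empty hLsub h
    · right; have := (sdim_mono hLsub).trans_lt h; omega
  -- base `(a, t)`, fibre `v`
  set Bh : Set (Fin (m + 1) → ℝ) := {b | (fibre b L).Nonempty ∧ sdim (fibre b L) = 1} with hBh
  obtain ⟨hBhsa, hform⟩ := sdim_fibre_formula (m := m + 1) (n := 1) hLsa 1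
  have hBhdim : Bh = ∅ ∨ sdim Bh + 1 ≤ m := by
    rcases Bh.eq_empty_or_nonempty with h | hne
    · exact Or.inl h
    · right
      have h := hform hne
      have hpart : sdim {z | z ∈ L ∧ (fibre (fun i => z (Fin.castAdd 1 i)) L).Nonempty ∧
          sdim (fibre (fun i => z (Fin.castAdd 1 i)) L) = 1} ≤ sdim L := sdim_mono fun z hz => hz.1
      rw [h] at hpart
      rcases hLdim with hLe | hLe
      · -- `L = ∅` contradicts `Bh` nonempty
        obtain ⟨b, ⟨v, hv⟩, -⟩ := hne
        rw [mem_fibre_iff, hLe] at hv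
        exact absurd hv (notMem_empty _)
      · exact hpart.trans hLe
  -- the bad set `Z = {a | snoc a 0 ∈ Bh}`
  set Z : Set (Fin m → ℝ) := {a | (Fin.snoc a 0 : Fin (m + 1) → ℝ) ∈ Bh} with hZ
  have hZsa : IsSemialgebraic ℝ Z := by
    have h := sa_exists (n := m) (P := fun a t => t = 0 ∧ (Fin.snoc a t : Fin (m + 1) → ℝ) ∈ Bh) ?_
    · convert h using 1
      ext a
      simp only [hZ, mem_setOf_eq]
      exact ⟨fun ha => ⟨0, rfl, ha⟩, fun ⟨t, ht, ha⟩ => by rw [ht] at ha; exact ha⟩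
    · have h1 : IsSemialgebraic ℝ {w : Fin (m + 1) → ℝ | w (Fin.last m) = 0} := by
        simpa using isSemialgebraic_setOf_eval_eq_zero (k := ℝ) (R := ℝ)
          (MvPolynomial.X (Fin.last m) : MvPolynomial (Fin (m + 1)) ℝ)
      convert h1.inter hBhsa using 1
      ext w
      simp only [mem_setOf_eq, mem_inter_iff, Fin.snoc_init_self]
      exact Iff.rfl
  have hZsub : Z ⊆ Fin.init '' Bh := fun a ha => ⟨Fin.snoc a 0, ha, by simp⟩
  have hZdim : Z = ∅ ∨ sdim Z < m := by
    rcases hBhdim with h | h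
    · left; exact eq_empty_of_forall_notMem fun a ha => by rw [hZ, mem_setOf_eq, h] at ha; exact ha
    · right
      have h1 : sdim Z ≤ sdim Bh := (sdim_mono hZsub).trans
        (sdim_image_le hBhsa (continuous_pi fun i => continuous_apply _).continuousOn
          ((isSemialgebraicMapOn_iff_forall_holds hBhsa).mpr fun j => isSemialgebraicFunOn_apply hBhsa (Fin.castSucc j)))
      omega
  refine ⟨Z, hZsa, hZdim, fun a ⟨ha, v₁, hv₁, v₂, hv₂, hne⟩ => ?_⟩
  -- two cluster values give an interval of cluster values, a fibre of dimension `1`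
  have hoc := ordConnected_clusterSet_halfBox hG hc ha
  have hfib : ∀ v, v ∈ clusterSet f S (Fin.snoc a 0) → (fun _ : Fin 1 => v) ∈ fibre (Fin.snoc a 0 : Fin (m + 1) → ℝ) L := by
    intro v hv
    rw [mem_fibre_iff, append_one_eq_snoc']
    refine ⟨(mem_clusterSet_iff_snoc_mem_closure).1 hv, ?_⟩
    show (Fin.snoc (Fin.snoc a 0 : Fin (m + 1) → ℝ) v : Fin (m + 1 + 1) → ℝ) (Fin.castSucc (Fin.last m)) = 0
    rw [Fin.snoc_castSucc, Fin.snoc_last]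
  rcases lt_or_gt_of_ne hne with hlt | hlt
  · refine ⟨⟨_, hfib v₁ hv₁⟩, le_antisymm (sdim_le _) ?_⟩
    refine one_le_sdim_of_Ioo_subset (0 : Fin 1) (fun _ => v₁) hlt fun t ht => ?_
    have : Function.update (fun _ : Fin 1 => v₁) 0 t = fun _ => t := by
      funext i; rw [Subsingleton.elim i 0, Function.update_self]
    rw [this]
    exact hfib t (hoc.out hv₁ hv₂ ⟨ht.1.le, ht.2.le⟩)
  · refine ⟨⟨_, hfib v₂ hv₂⟩, le_antisymm (sdim_le _) ?_⟩
    refine one_le_sdim_of_Ioo_subset (0 : Fin 1) (fun _ => v₂) hlt fun t ht => ?_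
    have : Function.update (fun _ : Fin 1 => v₂) 0 t = fun _ => t := by
      funext i; rw [Subsingleton.elim i 0, Function.update_self]
    rw [this]
    exact hfib t (hoc.out hv₂ hv₁ ⟨ht.1.le, ht.2.le⟩)

/-- **Generic limits at the bottom** [Pawlucki2024, Thm. 5.3, first step]: a bounded continuous
semialgebraic function on the half-box has, off a closed nowhere dense semialgebraic subset of the
base, a limit at every bottom point, depending continuously on the point.
[cite: Pawlucki2024, Thm. 5.3 (proof)] -/
theorem exists_limit_off_small (hG : IsOpen G) (hGs : IsSemialgebraic ℝ G) (hη : 0 < η)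
    (hc : ContinuousOn f (halfBox G η)) (hs : IsSemialgebraicFunOn ℝ (halfBox G η) f)
    {M : ℝ} (hM : ∀ z ∈ halfBox G η, |f z| ≤ M) :
    ∃ (Z : Set (Fin m → ℝ)) (lam : (Fin m → ℝ) → ℝ), IsSemialgebraic ℝ Z ∧ IsClosed Z ∧ (Z = ∅ ∨ sdim Z < m) ∧
      ContinuousOn lam (G \ Z) ∧
      ∀ a ∈ G \ Z, Tendsto f (𝓝[halfBox G η] (Fin.snoc a 0)) (𝓝 (lam a)) := by
  obtain ⟨Z₀, hZ₀sa, hZ₀dim, hbad⟩ := exists_small_of_two_clusterValues hG hGs hc hs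
  refine ⟨closure Z₀, fun a => Classical.epsilon fun v => v ∈ clusterSet f (halfBox G η) (Fin.snoc a 0),
    isSemialgebraic_closure hZ₀sa, isClosed_closure, ?_, ?_, ?_⟩
  · rcases hZ₀dim with h | h
    · left; rw [h, closure_empty]
    · right; rwa [sdim_closure hZ₀sa]
  · -- continuity from convergence
    have hlim : ∀ a ∈ G \ closure Z₀, Tendsto f (𝓝[halfBox G η] (Fin.snoc a 0))
        (𝓝 (Classical.epsilon fun v => v ∈ clusterSet f (halfBox G η) (Fin.snoc a 0))) :=
      fun a ha => tendsto_aux hG hη hc hM hbad ha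
    exact continuousOn_of_tendsto (q := fun a : Fin m → ℝ => (Fin.snoc a 0 : Fin (m + 1) → ℝ))
      (continuous_snoc_pair.comp (continuous_id.prodMk continuous_const)).continuousOn
      (fun a ha => neBot_nhdsWithin_halfBox hη ha.1) hlim
  · exact fun a ha => tendsto_aux hG hη hc hM hbad ha
where
  /-- convergence at good bottom points -/
  tendsto_aux (hG : IsOpen G) (hη : 0 < η) (hc : ContinuousOn f (halfBox G η)) {M : ℝ}
      (hM : ∀ z ∈ halfBox G η, |f z| ≤ M) {Z₀ : Set (Fin m → ℝ)}
      (hbad : {a | a ∈ G ∧ ∃ v₁ ∈ clusterSet f (halfBox G η) (Fin.snoc a 0),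
        ∃ v₂ ∈ clusterSet f (halfBox G η) (Fin.snoc a 0), v₁ ≠ v₂} ⊆ Z₀)
      {a : Fin m → ℝ} (ha : a ∈ G \ closure Z₀) :
      Tendsto f (𝓝[halfBox G η] (Fin.snoc a 0))
        (𝓝 (Classical.epsilon fun v => v ∈ clusterSet f (halfBox G η) (Fin.snoc a 0))) := by
    haveI := neBot_nhdsWithin_halfBox hη ha.1 (G := G)
    have hne : (clusterSet f (halfBox G η) (Fin.snoc a 0)).Nonempty :=
      clusterSet_nonempty_of_bounded hM (mem_closure_iff_nhdsWithin_neBot.2 inferInstance)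
    have hv₀ := Classical.epsilon_spec hne
    obtain ⟨δ₀, hδ₀, hball⟩ := Metric.isOpen_iff.1 hG a ha.1
    refine tendsto_of_clusterSet_subset hc hδ₀ (fun δ _ hδle => convex_halfBox_inter_ball hball hδle) hv₀
      fun v hv => ?_
    by_contra hne'
    exact ha.2 (subset_closure (hbad ⟨ha.1, v, hv, _, hv₀, hne'⟩))

end HalfBox

end Literature.ModelTheory.ExponentialFields
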